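/-
Copyright (c) 2026 the pub-hodgecm-mathlib formalisation cell (harness21).  Prover seat hodgecm-mathlib-K2Liu-p02 (g7), Track B «K2-LIT» ∕ hLiu418
#184♮, socket #42F′ TOP (U5 lineage; LEAD F0P6-plan (g14) BATCH #39 (2): the COINVARIANCE adapter's instance input (F2) of K2Liu-p02's 15:2xZ census).
THEOREMS ONLY (no `def`, no `instance`, no notation, no named-fact hypothesis, no `sorry`).
-/
import Summits.HodgeConjecture.HodgeConjecture.Theorems.K2LiuFirstTermResidueForm   -- ★ U0.4 `resNorm_smul`, `resNorm_add`; brings `resNorm`, `eisensteinFamilyDelta`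
import HarnessLib

/-!
# Crux `HLiu418`, Road I (#42F′ by uniqueness), U5 TOP, (F2) «A MAP THAT READS ITS ARGUMENT THROUGH A SECTION FAMILY TRANSFORMS LIKE THE FAMILY»:
# `g_{x′} = c • g_x ⟹ T x′ = c · T x` for every `T` carrying ★ U5-0c's clause (b)

Cell `hodgecm-mathlib`, crux item hLiu418 = `stmt-HodgeConjecture-24832`; squad K2 ∕ K2Liu, prover K2Liu-p02 (g7); lane `--supports stmt-HodgeConjecture-24832 --as helper`,
count-neutral.  Namespace `Summit.HodgeConjecture.HodgeConjecture.Cruxes.HLiu418.K2LiuResidueMapSemiInvariance`.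

THE POINT (K2Liu-p02 (g7) coinvariance census, input (F2) = the K2Lit-currency instance of ★ p861181 §1 `apply_eq_transport_of_section`).  ★ U5-0c
`exists_linear_residueMap` delivers the residue map `T₁` with clause (b): «`T₁ x = resNorm P Es` for SOME pole-cleared continuation `(P, Es)` of `E^Δ(s; g_x)`» (holomorphy
on `{0 < re s}` + the defining equation on `{n∕2 < re s}` among its five clauses).  For ANY map `T : D → (H(𝔸) → ℂ)` with that clause for a family assignment
`x ↦ g_x` (`fam`), ★ U0.4 `resNorm_smul` (K2Liu-p03 (g4); the residue is linear in the family across arbitrary admissible continuations) gives at once: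
**`fam x′ = c • fam x ⟹ T x′ = c · T x`** (`apply_eq_mul_of_family_eq_smul`) and **`fam x″ = fam x + fam x′ ⟹ T x″ = T x + T x′`** (`apply_eq_add_of_family_eq_add`),
the section-family side needing only `IsSiegelDeltaSection` + continuity of the family `g_x` (★ O42.3g `isSiegelDeltaSection_swTensorTwisted` ∕ `continuous_swTensorTwisted` at
the instance).  With ★ (F1) `K2LiuSiegelWeilTensorPartnerLaw.twistedStdExtension_swSectionTensor_omega_eq_smul` (`g_{ω(sB q)Φ} = χ′(q) • g_Φ` for a Siegel element `q`
of the big doubled group commuting with `tensorEmb`) this is the `(U(V′)(𝔸), χ′)`-SEMI-INVARIANCE of `T₁` — input `hT` of ★ p861181 §2.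
[KudlaRallis1994, §1 Thm. 1.1; HarrisKudlaSweet1996, §1 (1.15)–(1.17); GanQiuTakeda2014, §7 Thm. 20 (i).]

HONEST LABEL.  Count-neutral helper: `HC_CM` is proved only modulo the 7 printed citations (2 remaining named inputs: hLiu418 = `stmt-HodgeConjecture-24832`,
h413 = `stmt-HodgeConjecture-24833`) until rung 0 closes; closes no socket by itself.
-/

set_option autoImplicit false
set_option linter.dupNamespace false -- the mandated namespace repeats `HodgeConjecture.HodgeConjecture`

noncomputable section

open NumberField IsDedekindDomain
open scoped BigOperators

namespace Summit.HodgeConjecture.HodgeConjecture.Cruxes.HLiu418.K2LiuResidueMapSemiInvariance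

open Literature.NumberTheory.Automorphic
open Literature.NumberTheory.GaloisRepresentations
open Literature.NumberTheory.GelbartRogawski1991 Literature.NumberTheory.GelbartRogawski1991.GRConstruction
open Literature.NumberTheory.K2Lit.SiegelDoubled
open Summit.HodgeConjecture.HodgeConjecture.Cruxes.HLiu418.K2LiuFirstTermResidueFormDefs
open Summit.HodgeConjecture.HodgeConjecture.Cruxes.HLiu418.K2LiuFirstTermResidueForm

variable (L : Type) [Field L] [NumberField L] [IsCMField L]
variable {N M n : ℕ} (e : Fin N × Fin M ≃ Fin n)
  (dV : Fin N → L) (hdV : ∀ i, IsCMField.complexConj L (dV i) = dV i) (hdV0 : ∀ i, dV i ≠ 0)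
  (dW : Fin M → L) (hdW : ∀ i, IsCMField.complexConj L (dW i) = dW i) (hdW0 : ∀ i, dW i ≠ 0)

include hdV0 hdW0 in
/-- **(F2, scalar) A MAP READING ITS ARGUMENT THROUGH A SECTION FAMILY IS SEMI-INVARIANT WHEN THE FAMILY IS.**  `T : D → (H(𝔸) → ℂ)` with ★ U5-0c's clause (b) for the
family assignment `fam` («`T x = resNorm P Es` for some pole-cleared continuation of `E^Δ(s; fam x)`», holomorphy + defining equation); if `fam x′ = c • fam x` with `fam x` a
continuous Siegel section family, then `T x′ = c · T x` (★ `resNorm_smul` across the two continuations).  At the instance (`x′ = ω(sB(1 ⊗ k)) x`, ★ (F1)): the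
`(U(V′)(𝔸), χ′)`-semi-invariance of the residue map. [cite: KudlaRallis1994, §1 Thm. 1.1] [cite: HarrisKudlaSweet1996, §1 (1.15)–(1.17)] -/
theorem apply_eq_mul_of_family_eq_smul {D : Type*} (χ : HeckeCharacter L) (hχ : χ.IsUnitary)
    (T : D → HA L e dV hdV dW hdW → ℂ) (fam : D → ℂ → HA L e dV hdV dW hdW → ℂ)
    (hex : ∀ x : D, ∃ (P : Finset ℂ) (Es : ℂ → HA L e dV hdV dW hdW → ℂ),
      (∀ h : HA L e dV hdV dW hdW, DifferentiableOn ℂ (fun s => Es s h) {s : ℂ | 0 < s.re}) ∧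
      (∀ (s : ℂ) (h : HA L e dV hdV dW hdW), (n : ℝ) / 2 < s.re →
        Es s h = (∏ p ∈ P, (s - p)) * eisensteinFamilyDelta L e dV hdV dW hdW (fam x) s h) ∧
      T x = resNorm P Es)
    {x x' : D} {c : ℂ} (hfam : fam x' = c • fam x)
    (hg : ∀ s, IsSiegelDeltaSection L e dV hdV dW hdW χ s (fam x s)) (hgc : ∀ s, Continuous (fam x s)) :
    T x' = fun h => c * T x h := by
  obtain ⟨P', Es', hhol', heq', hT'⟩ := hex x'
  obtain ⟨P, Es, hhol, heq, hT⟩ := hex x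
  rw [hT', hT]
  exact resNorm_smul L e dV hdV hdV0 dW hdW hdW0 χ hχ c (fam x) hg hgc (fam x') hfam P' Es' hhol' heq' P Es hhol heq

include hdV0 hdW0 in
/-- **(F2, scalar, pointwise)**: `T x′ h = c · T x h`. [cite: KudlaRallis1994, §1 Thm. 1.1] -/
theorem apply_apply_eq_mul_of_family_eq_smul {D : Type*} (χ : HeckeCharacter L) (hχ : χ.IsUnitary)
    (T : D → HA L e dV hdV dW hdW → ℂ) (fam : D → ℂ → HA L e dV hdV dW hdW → ℂ)
    (hex : ∀ x : D, ∃ (P : Finset ℂ) (Es : ℂ → HA L e dV hdV dW hdW → ℂ),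
      (∀ h : HA L e dV hdV dW hdW, DifferentiableOn ℂ (fun s => Es s h) {s : ℂ | 0 < s.re}) ∧
      (∀ (s : ℂ) (h : HA L e dV hdV dW hdW), (n : ℝ) / 2 < s.re →
        Es s h = (∏ p ∈ P, (s - p)) * eisensteinFamilyDelta L e dV hdV dW hdW (fam x) s h) ∧
      T x = resNorm P Es)
    {x x' : D} {c : ℂ} (hfam : fam x' = c • fam x)
    (hg : ∀ s, IsSiegelDeltaSection L e dV hdV dW hdW χ s (fam x s)) (hgc : ∀ s, Continuous (fam x s)) (h : HA L e dV hdV dW hdW) :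
    T x' h = c * T x h :=
  congrFun (apply_eq_mul_of_family_eq_smul L e dV hdV hdV0 dW hdW hdW0 χ hχ T fam hex hfam hg hgc) h

include hdV0 hdW0 in
/-- **(F2, invariant case)**: `fam x′ = fam x ⟹ T x′ = T x` — e.g. `K′ ≤ ker χ′` acting on `x` (★ (Avg) `K2LiuDoubledWeilKPrimeAverage`): the residue map does not see the
`K′`-average. [cite: KudlaRallis1994, §1 Thm. 1.1] -/
theorem apply_eq_of_family_eq {D : Type*} (χ : HeckeCharacter L) (hχ : χ.IsUnitary)
    (T : D → HA L e dV hdV dW hdW → ℂ) (fam : D → ℂ → HA L e dV hdV dW hdW → ℂ)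
    (hex : ∀ x : D, ∃ (P : Finset ℂ) (Es : ℂ → HA L e dV hdV dW hdW → ℂ),
      (∀ h : HA L e dV hdV dW hdW, DifferentiableOn ℂ (fun s => Es s h) {s : ℂ | 0 < s.re}) ∧
      (∀ (s : ℂ) (h : HA L e dV hdV dW hdW), (n : ℝ) / 2 < s.re →
        Es s h = (∏ p ∈ P, (s - p)) * eisensteinFamilyDelta L e dV hdV dW hdW (fam x) s h) ∧
      T x = resNorm P Es)
    {x x' : D} (hfam : fam x' = fam x)
    (hg : ∀ s, IsSiegelDeltaSection L e dV hdV dW hdW χ s (fam x s)) (hgc : ∀ s, Continuous (fam x s)) :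
    T x' = T x := by
  have h1 : fam x' = (1 : ℂ) • fam x := by rw [one_smul]; exact hfam
  rw [apply_eq_mul_of_family_eq_smul L e dV hdV hdV0 dW hdW hdW0 χ hχ T fam hex h1 hg hgc]
  funext h
  rw [one_mul]

include hdV0 hdW0 in
/-- **(F2, additive) THE SAME MAP IS ADDITIVE ALONG THE FAMILY**: `fam x″ = fam x + fam x′ ⟹ T x″ = T x + T x′` (★ `resNorm_add` across the three continuations) — the
reading behind ★ U5-0c's linearity, restated for any `T` with clause (b). [cite: KudlaRallis1994, §1 Thm. 1.1] -/
theorem apply_eq_add_of_family_eq_add {D : Type*} (χ : HeckeCharacter L) (hχ : χ.IsUnitary)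
    (T : D → HA L e dV hdV dW hdW → ℂ) (fam : D → ℂ → HA L e dV hdV dW hdW → ℂ)
    (hex : ∀ x : D, ∃ (P : Finset ℂ) (Es : ℂ → HA L e dV hdV dW hdW → ℂ),
      (∀ h : HA L e dV hdV dW hdW, DifferentiableOn ℂ (fun s => Es s h) {s : ℂ | 0 < s.re}) ∧
      (∀ (s : ℂ) (h : HA L e dV hdV dW hdW), (n : ℝ) / 2 < s.re →
        Es s h = (∏ p ∈ P, (s - p)) * eisensteinFamilyDelta L e dV hdV dW hdW (fam x) s h) ∧
      T x = resNorm P Es)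
    {x x' x'' : D} (hfam : fam x'' = fam x + fam x')
    (hg : ∀ s, IsSiegelDeltaSection L e dV hdV dW hdW χ s (fam x s)) (hgc : ∀ s, Continuous (fam x s))
    (hg' : ∀ s, IsSiegelDeltaSection L e dV hdV dW hdW χ s (fam x' s)) (hgc' : ∀ s, Continuous (fam x' s)) :
    T x'' = fun h => T x h + T x' h := by
  obtain ⟨P'', Es'', hhol'', heq'', hT''⟩ := hex x''
  obtain ⟨P, Es, hhol, heq, hT⟩ := hex x
  obtain ⟨P', Es', hhol', heq', hT'⟩ := hex x'
  rw [hT'', hT, hT']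
  exact resNorm_add L e dV hdV hdV0 dW hdW hdW0 χ hχ (fam x) (fam x') hg hgc hg' hgc' (fam x'') hfam P'' Es'' hhol'' heq''
    P Es hhol heq P' Es' hhol' heq'

end Summit.HodgeConjecture.HodgeConjecture.Cruxes.HLiu418.K2LiuResidueMapSemiInvariance

end
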